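import Summits.QuantumFields.YangMills.Theorems.SwapVirialDeficitZeroModeThreeClosedFormGauss
import HarnessLib

/-!
# The `k = 3` zero-mode block is REGULAR, IX: the CLOSED FORM `A₃ = 4π⁴√(2π)` — part 2, the hub and axial integrals
# (free-hands support of ⟨stmt-QuantumFields-24197⟩; pins the constant of w3 g62's ✓`tendsto_zeroModeZ_three`)

After part 1 (✓`lintegral_hlim_eq`), `A₃ = ∫_{ℝ³} da ∫_{ℝ²} dz π²·e^{−(|z|²+‖a‖²)/2}/(‖a‖²(‖a‖² + |z|²))`.  The two denominators are linearised by
`e^{−Y/2}/Y = ∫_{1/2}^∞ e^{−cY} dc` and `1/X = ∫₀^∞ e^{−uX} du` (✓`integral_exp_mul_Ioi`); after Tonelli only Gaussian integrals remain: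
`∫_{ℝ³} e^{−κ‖a‖²} = (π/κ)^{3/2}`, `∫_{ℝ²} e^{−c|z|²} = π/c`, then `∫₀^∞ (c+u)^{−3/2} du = 2c^{−1/2}` and `∫_{1/2}^∞ c^{−3/2} dc = 2√2`:
★★★ `A3_eq : A3 = 4·π⁴·√(2π)` (the value announced, not proved, in the docstring of ✓`A3`).
HONEST LABEL: finite-dimensional calculus (plan-level zero-mode rung of a DRAFT line «sharp-sigma»); NOT the fixed-`L` sharp law, NOT ⟨24197⟩; the Yang–Mills
mass gap is NOT proved; no summit is proved by a line.  Width seat ym-line-sfw-p2-w2 g56 (cell ym-idea-1, free hands; own crux ⟨22884⟩ blocked-on ⟨19935⟩),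
`--supports stmt-QuantumFields-24197`.  THEOREMS ONLY, standard axioms, 0 `sorry`.  References: [folklore].
-/

set_option autoImplicit false

noncomputable section
namespace Summit.QuantumFields.YangMills.Theorems.ToronValleyVolume.ZeroMode

open MeasureTheory Real Finset Set Filter
open scoped ENNReal Topology
open Summit.QuantumFields.YangMills.Cruxes.ToronTubeVolumeLaw.Birth

/-! ## §24 Linearising the denominators -/

/-- `∫_{(1/2,∞)} e^{−Yc} dc = e^{−Y/2}/Y` for `Y > 0` (lower integral). [folklore] -/
theorem lintegral_Ioi_half_exp {Y : ℝ} (hY : 0 < Y) :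
    ∫⁻ c in Ioi (1/2 : ℝ), ENNReal.ofReal (Real.exp (-Y * c)) = ENNReal.ofReal (Real.exp (-(Y / 2)) / Y) := by
  rw [← ofReal_integral_eq_lintegral_ofReal (exp_neg_integrableOn_Ioi _ hY) (ae_of_all _ fun c => (Real.exp_pos _).le)]
  congr 1
  rw [integral_exp_mul_Ioi (by linarith : -Y < 0), neg_div_neg_eq]
  congr 2; ring

/-- `∫_{(0,∞)} e^{−Xu} du = 1/X` for `X > 0` (lower integral). [folklore] -/
theorem lintegral_Ioi_zero_exp {X : ℝ} (hX : 0 < X) :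
    ∫⁻ u in Ioi (0 : ℝ), ENNReal.ofReal (Real.exp (-X * u)) = ENNReal.ofReal (1 / X) := by
  rw [← ofReal_integral_eq_lintegral_ofReal (exp_neg_integrableOn_Ioi _ hX) (ae_of_all _ fun c => (Real.exp_pos _).le)]
  congr 1
  rw [integral_exp_mul_Ioi (by linarith : -X < 0), neg_div_neg_eq, mul_zero, Real.exp_zero]

/-- The parameter measure `ρ = vol|_{(1/2,∞)} ⊗ vol|_{(0,∞)}` of the two linearisations. [folklore] -/
def rhoCU : Measure (ℝ × ℝ) := ((volume : Measure ℝ).restrict (Ioi (1/2 : ℝ))).prod ((volume : Measure ℝ).restrict (Ioi (0 : ℝ)))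

/-- The linearised integrand `F((a,z),(c,u)) = e^{−(c+u)‖a‖²}·e^{−c|z|²}`. [folklore] -/
def Flin (p : (EuclideanSpace ℝ (Fin 3) × (ℝ × ℝ)) × (ℝ × ℝ)) : ℝ≥0∞ :=
  ENNReal.ofReal (Real.exp (-((p.2.1 + p.2.2) * ‖p.1.1‖ ^ 2))) * ENNReal.ofReal (Real.exp (-(p.2.1 * (p.1.2.1 ^ 2 + p.1.2.2 ^ 2))))

/-- `Flin` is measurable. [folklore] -/
theorem measurable_Flin : Measurable Flin := by
  unfold Flin
  exact (ENNReal.measurable_ofReal.comp (Real.measurable_exp.comp (by fun_prop))).mul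
    (ENNReal.measurable_ofReal.comp (Real.measurable_exp.comp (by fun_prop)))

/-- ★ **Pointwise linearisation**: for `a ≠ 0`,
`π²/(‖a‖²(‖a‖²+|z|²))·e^{−(|z|²+‖a‖²)/2} = π²·∫ F((a,z),·) dρ`. [folklore] -/
theorem integrand_eq_lintegral_Flin {a : EuclideanSpace ℝ (Fin 3)} (ha : a ≠ 0) (z : ℝ × ℝ) :
    ENNReal.ofReal (Real.pi ^ 2 / (‖a‖ ^ 2 * (‖a‖ ^ 2 + z.1 ^ 2 + z.2 ^ 2))) * wz ‖a‖ z =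
      ENNReal.ofReal (Real.pi ^ 2) * ∫⁻ q, Flin ((a, z), q) ∂rhoCU := by
  have hX : 0 < ‖a‖ ^ 2 := by positivity
  have hS : 0 ≤ z.1 ^ 2 + z.2 ^ 2 := by positivity
  have hY : 0 < ‖a‖ ^ 2 + (z.1 ^ 2 + z.2 ^ 2) := by positivity
  -- the product structure of `F((a,z),·)`
  have hF : ∀ q : ℝ × ℝ, Flin ((a, z), q) = ENNReal.ofReal (Real.exp (-(‖a‖ ^ 2 + (z.1 ^ 2 + z.2 ^ 2)) * q.1)) *
      ENNReal.ofReal (Real.exp (-‖a‖ ^ 2 * q.2)) := by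
    intro q
    unfold Flin
    rw [← ENNReal.ofReal_mul (Real.exp_pos _).le, ← ENNReal.ofReal_mul (Real.exp_pos _).le, ← Real.exp_add, ← Real.exp_add]
    congr 2; ring
  simp_rw [hF]
  have hm1 : Measurable fun c : ℝ => ENNReal.ofReal (Real.exp (-(‖a‖ ^ 2 + (z.1 ^ 2 + z.2 ^ 2)) * c)) :=
    ENNReal.measurable_ofReal.comp (Real.measurable_exp.comp (by fun_prop))
  have hm2 : Measurable fun u : ℝ => ENNReal.ofReal (Real.exp (-‖a‖ ^ 2 * u)) :=
    ENNReal.measurable_ofReal.comp (Real.measurable_exp.comp (by fun_prop))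
  rw [rhoCU, lintegral_prod_mul hm1.aemeasurable hm2.aemeasurable, lintegral_Ioi_half_exp hY, lintegral_Ioi_zero_exp hX, wz_def,
    ← ENNReal.ofReal_mul (by positivity), ← ENNReal.ofReal_mul (by positivity), ← ENNReal.ofReal_mul (by positivity)]
  congr 1
  have e : -((z.1 ^ 2 + z.2 ^ 2 + ‖a‖ ^ 2) / 2) = -((‖a‖ ^ 2 + (z.1 ^ 2 + z.2 ^ 2)) / 2) := by ring
  rw [e]
  field_simp
  ring

/-! ## §25 The Gaussian integrals -/

/-- `‖toLp(snoc p t)‖² = p₀² + p₁² + t²`. [folklore] -/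
theorem norm_sq_toLp_snoc (p : Fin 2 → ℝ) (t : ℝ) : ‖(WithLp.toLp 2 (Fin.snoc p t : Fin 3 → ℝ) : EuclideanSpace ℝ (Fin 3))‖ ^ 2 = p 0 ^ 2 + p 1 ^ 2 + t ^ 2 := by
  have h2 : (WithLp.toLp 2 (Fin.snoc p t : Fin 3 → ℝ) : EuclideanSpace ℝ (Fin 3)).ofLp 2 = t := snoc2_apply_two p t
  rw [normSq_eq_plSq_add, plSq_toLp_snoc, h2]

/-- ★ The Gaussian on `ℝ³`: `∫ e^{−κ‖a‖²} da = √(π/κ)·(π/κ)` (`κ > 0`). [folklore] -/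
theorem lintegral_gauss_euclid3 {κ : ℝ} (hκ : 0 < κ) :
    ∫⁻ a : EuclideanSpace ℝ (Fin 3), ENNReal.ofReal (Real.exp (-(κ * ‖a‖ ^ 2))) = ENNReal.ofReal (Real.sqrt (Real.pi / κ) * (Real.pi / κ)) := by
  have hg : Measurable fun a : EuclideanSpace ℝ (Fin 3) => ENNReal.ofReal (Real.exp (-(κ * ‖a‖ ^ 2))) :=
    ENNReal.measurable_ofReal.comp (Real.measurable_exp.comp (by fun_prop))
  rw [lintegral_euclid3 _ hg]
  have hpt : ∀ (t : ℝ) (p : Fin 2 → ℝ), ENNReal.ofReal (Real.exp (-(κ * ‖(WithLp.toLp 2 (Fin.snoc p t : Fin 3 → ℝ) : EuclideanSpace ℝ (Fin 3))‖ ^ 2))) =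
      ENNReal.ofReal (Real.exp (-(κ * (p 0 ^ 2 + p 1 ^ 2)))) * ENNReal.ofReal (Real.exp (-κ * t ^ 2)) := by
    intro t p
    rw [norm_sq_toLp_snoc, ← ENNReal.ofReal_mul (Real.exp_pos _).le, ← Real.exp_add]
    congr 2; ring
  simp_rw [hpt]
  have hm : Measurable fun p : Fin 2 → ℝ => ENNReal.ofReal (Real.exp (-(κ * (p 0 ^ 2 + p 1 ^ 2)))) :=
    ENNReal.measurable_ofReal.comp (Real.measurable_exp.comp (by fun_prop))
  have hin : ∀ t : ℝ, ∫⁻ p : Fin 2 → ℝ, ENNReal.ofReal (Real.exp (-(κ * (p 0 ^ 2 + p 1 ^ 2)))) * ENNReal.ofReal (Real.exp (-κ * t ^ 2)) =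
      ENNReal.ofReal (Real.pi / κ) * ENNReal.ofReal (Real.exp (-κ * t ^ 2)) := by
    intro t; rw [lintegral_mul_const _ hm, lintegral_planar_gauss κ hκ]
  simp_rw [hin]
  have hm1 : Measurable fun t : ℝ => ENNReal.ofReal (Real.exp (-κ * t ^ 2)) := ENNReal.measurable_ofReal.comp (by fun_prop)
  rw [lintegral_const_mul _ hm1, lintegral_gauss κ hκ, ← ENNReal.ofReal_mul (by positivity), mul_comm]

/-- ★ The Gaussian on `ℝ²`: `∫ e^{−c(z₁²+z₂²)} dz = π/c` (`c > 0`). [folklore] -/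
theorem lintegral_gauss_prod {c : ℝ} (hc : 0 < c) :
    ∫⁻ z : ℝ × ℝ, ENNReal.ofReal (Real.exp (-(c * (z.1 ^ 2 + z.2 ^ 2)))) = ENNReal.ofReal (Real.pi / c) := by
  have hpt : ∀ z : ℝ × ℝ, ENNReal.ofReal (Real.exp (-(c * (z.1 ^ 2 + z.2 ^ 2)))) =
      ENNReal.ofReal (Real.exp (-c * z.1 ^ 2)) * ENNReal.ofReal (Real.exp (-c * z.2 ^ 2)) := by
    intro z; rw [← ENNReal.ofReal_mul (Real.exp_pos _).le, ← Real.exp_add]; congr 2; ring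
  simp_rw [hpt]
  have hm : Measurable fun x : ℝ => ENNReal.ofReal (Real.exp (-c * x ^ 2)) := ENNReal.measurable_ofReal.comp (by fun_prop)
  rw [Measure.volume_eq_prod, lintegral_prod_mul hm.aemeasurable hm.aemeasurable, lintegral_gauss c hc,
    ← ENNReal.ofReal_mul (Real.sqrt_nonneg _), Real.mul_self_sqrt (by positivity)]

/-- ★ **The `(a,z)`-integral of `F` at parameters `(c,u)`** (`c > 0`, `c + u > 0`):
`∫∫ F((a,z),(c,u)) = √(π/(c+u))·(π/(c+u)) · (π/c)`. [folklore] -/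
theorem lintegral_Flin_az {c u : ℝ} (hc : 0 < c) (hcu : 0 < c + u) :
    ∫⁻ w : EuclideanSpace ℝ (Fin 3) × (ℝ × ℝ), Flin (w, (c, u)) =
      ENNReal.ofReal (Real.sqrt (Real.pi / (c + u)) * (Real.pi / (c + u))) * ENNReal.ofReal (Real.pi / c) := by
  have hm1 : Measurable fun a : EuclideanSpace ℝ (Fin 3) => ENNReal.ofReal (Real.exp (-((c + u) * ‖a‖ ^ 2))) :=
    ENNReal.measurable_ofReal.comp (Real.measurable_exp.comp (by fun_prop))
  have hm2 : Measurable fun z : ℝ × ℝ => ENNReal.ofReal (Real.exp (-(c * (z.1 ^ 2 + z.2 ^ 2)))) :=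
    ENNReal.measurable_ofReal.comp (Real.measurable_exp.comp (by fun_prop))
  unfold Flin
  rw [Measure.volume_eq_prod, lintegral_prod_mul hm1.aemeasurable hm2.aemeasurable, lintegral_gauss_euclid3 hcu, lintegral_gauss_prod hc]

/-! ## §26 The two parameter integrals -/

/-- `√(π/κ)·(π/κ)·(π/c) = π²√π · (κ^{−3/2}·c⁻¹)` (`κ, c > 0`). [folklore] -/
theorem gauss_product_eq {κ c : ℝ} (hκ : 0 < κ) (hc : 0 < c) :
    Real.sqrt (Real.pi / κ) * (Real.pi / κ) * (Real.pi / c) = Real.pi ^ 2 * Real.sqrt Real.pi * (κ ^ (-(3/2 : ℝ)) * c⁻¹) := by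
  rw [Real.sqrt_div' _ hκ.le, Real.sqrt_eq_rpow κ, Real.rpow_neg hκ.le,
    show κ ^ ((3/2 : ℝ)) = κ ^ (1 / 2 : ℝ) * κ by
      rw [show (3/2 : ℝ) = 1 / 2 + 1 by norm_num, Real.rpow_add hκ, Real.rpow_one]]
  have h1 : 0 < κ ^ (1 / 2 : ℝ) := Real.rpow_pos_of_pos hκ _
  field_simp

/-- ★ `∫_{(0,∞)} (c+u)^{−3/2} du = 2c^{−1/2}` (`c > 0`; translation + ✓`integral_Ioi_rpow_of_lt`). [folklore] -/
theorem lintegral_Ioi_rpow_shift {c : ℝ} (hc : 0 < c) :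
    ∫⁻ u in Ioi (0 : ℝ), ENNReal.ofReal ((c + u) ^ (-(3/2 : ℝ))) = ENNReal.ofReal (2 * c ^ (-(1/2 : ℝ))) := by
  have hg : ∫⁻ u in Ioi (0 : ℝ), ENNReal.ofReal ((c + u) ^ (-(3/2 : ℝ))) = ∫⁻ v in Ioi c, ENNReal.ofReal (v ^ (-(3/2 : ℝ))) := by
    rw [← lintegral_indicator measurableSet_Ioi, ← lintegral_indicator measurableSet_Ioi,
      ← lintegral_add_right_eq_self (fun v => (Ioi c).indicator (fun v => ENNReal.ofReal (v ^ (-(3/2 : ℝ)))) v) c]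
    refine lintegral_congr fun u => ?_
    by_cases hu : u ∈ Ioi (0 : ℝ)
    · have hu' : u + c ∈ Ioi c := by simp only [Set.mem_Ioi] at hu ⊢; linarith
      rw [indicator_of_mem hu, indicator_of_mem hu', add_comm]
    · have hu' : u + c ∉ Ioi c := by simp only [Set.mem_Ioi, not_lt] at hu ⊢; linarith
      rw [indicator_of_notMem hu, indicator_of_notMem hu']
  rw [hg, ← ofReal_integral_eq_lintegral_ofReal (integrableOn_Ioi_rpow_of_lt (by norm_num) hc)
    (ae_restrict_of_forall_mem measurableSet_Ioi fun v hv => Real.rpow_nonneg (le_of_lt (lt_trans hc hv)) _),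
    integral_Ioi_rpow_of_lt (by norm_num) hc]
  congr 1
  norm_num; ring_nf

/-- ★ The `u`-integral: `∫_{(0,∞)} ∫∫F((a,z),(c,u)) du = π²√π·(2c^{−1/2}·c⁻¹)` (`c > 0`). [folklore] -/
theorem lintegral_u {c : ℝ} (hc : 0 < c) :
    ∫⁻ u in Ioi (0 : ℝ), ∫⁻ w : EuclideanSpace ℝ (Fin 3) × (ℝ × ℝ), Flin (w, (c, u)) =
      ENNReal.ofReal (Real.pi ^ 2 * Real.sqrt Real.pi) * (ENNReal.ofReal (2 * c ^ (-(1/2 : ℝ))) * ENNReal.ofReal c⁻¹) := by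
  have heq : ∀ u ∈ Ioi (0 : ℝ), ∫⁻ w : EuclideanSpace ℝ (Fin 3) × (ℝ × ℝ), Flin (w, (c, u)) =
      ENNReal.ofReal (Real.pi ^ 2 * Real.sqrt Real.pi) * (ENNReal.ofReal ((c + u) ^ (-(3/2 : ℝ))) * ENNReal.ofReal c⁻¹) := by
    intro u hu
    have hcu : 0 < c + u := by simp only [Set.mem_Ioi] at hu; linarith
    rw [lintegral_Flin_az hc hcu, ← ENNReal.ofReal_mul (by positivity), gauss_product_eq hcu hc, ENNReal.ofReal_mul (by positivity),
      ENNReal.ofReal_mul (Real.rpow_nonneg hcu.le _)]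
  have hm : Measurable fun u : ℝ => ENNReal.ofReal ((c + u) ^ (-(3/2 : ℝ))) := ENNReal.measurable_ofReal.comp (by fun_prop)
  have hm' : Measurable fun u : ℝ => ENNReal.ofReal ((c + u) ^ (-(3/2 : ℝ))) * ENNReal.ofReal c⁻¹ := hm.mul_const _
  rw [setLIntegral_congr_fun measurableSet_Ioi heq, lintegral_const_mul _ hm', lintegral_mul_const _ hm, lintegral_Ioi_rpow_shift hc]

/-- ★ The `c`-integral: `∫_{(1/2,∞)} 2c^{−1/2}·c⁻¹ dc = 4√2`. [folklore] -/
theorem lintegral_c : ∫⁻ c in Ioi (1/2 : ℝ), ENNReal.ofReal (2 * c ^ (-(1/2 : ℝ))) * ENNReal.ofReal c⁻¹ = ENNReal.ofReal (4 * Real.sqrt 2) := by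
  have heq : ∀ c ∈ Ioi (1/2 : ℝ), ENNReal.ofReal (2 * c ^ (-(1/2 : ℝ))) * ENNReal.ofReal c⁻¹ = 2 * ENNReal.ofReal (c ^ (-(3/2 : ℝ))) := by
    intro c hc
    have hc' : 0 < c := by simp only [Set.mem_Ioi] at hc; linarith
    rw [← ENNReal.ofReal_mul (by positivity), show 2 * c ^ (-(1/2 : ℝ)) * c⁻¹ = 2 * c ^ (-(3/2 : ℝ)) by
      rw [show (-(3/2 : ℝ)) = -(1/2 : ℝ) + (-1) by norm_num, Real.rpow_add hc', Real.rpow_neg_one]; ring,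
      ENNReal.ofReal_mul (by norm_num), ENNReal.ofReal_ofNat]
  have hm : Measurable fun c : ℝ => ENNReal.ofReal (c ^ (-(3/2 : ℝ))) := ENNReal.measurable_ofReal.comp (by fun_prop)
  rw [setLIntegral_congr_fun measurableSet_Ioi heq, lintegral_const_mul _ hm,
    ← ofReal_integral_eq_lintegral_ofReal (integrableOn_Ioi_rpow_of_lt (by norm_num) (by norm_num))
      (ae_restrict_of_forall_mem measurableSet_Ioi fun v hv => Real.rpow_nonneg (by simp only [Set.mem_Ioi] at hv; linarith) _),
    integral_Ioi_rpow_of_lt (by norm_num) (by norm_num), ← ENNReal.ofReal_ofNat, ← ENNReal.ofReal_mul (by norm_num)]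
  congr 1
  have h : (1/2 : ℝ) ^ (-(3/2 : ℝ) + 1) = Real.sqrt 2 := by
    rw [show (-(3/2 : ℝ) + 1) = -(1/2 : ℝ) by norm_num, Real.rpow_neg (by norm_num), ← Real.sqrt_eq_rpow, Real.sqrt_div' _ (by norm_num),
      Real.sqrt_one]
    field_simp
  rw [h]; norm_num; ring

/-! ## §27 Tonelli and the closed form -/

/-- ★★ **`A₃` after the transverse Gaussians and the linearisation**: `A₃ = π²·∫dρ(c,u) ∫∫ F((a,z),(c,u))`. [folklore] -/
theorem ofReal_A3_eq_lintegral_Flin :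
    ENNReal.ofReal A3 = ENNReal.ofReal (Real.pi ^ 2) * ∫⁻ q, (∫⁻ w : EuclideanSpace ℝ (Fin 3) × (ℝ × ℝ), Flin (w, q)) ∂rhoCU := by
  haveI : SFinite rhoCU := by unfold rhoCU; infer_instance
  rw [ofReal_A3_eq]
  -- a.e. hub `a ≠ 0`
  have hae : ∀ᵐ a : EuclideanSpace ℝ (Fin 3), a ≠ 0 := by
    have h0 : (volume : Measure (EuclideanSpace ℝ (Fin 3))) {0} = 0 := measure_singleton 0
    exact ae_iff.2 (by simpa only [ne_eq, not_not, setOf_eq_eq_singleton] using h0)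
  have h1 : ∫⁻ a : EuclideanSpace ℝ (Fin 3), ∫⁻ y, ENNReal.ofReal (hlim ‖a‖ y) =
      ∫⁻ a : EuclideanSpace ℝ (Fin 3), ∫⁻ z : ℝ × ℝ, ENNReal.ofReal (Real.pi ^ 2) * ∫⁻ q, Flin ((a, z), q) ∂rhoCU := by
    refine lintegral_congr_ae (hae.mono fun a ha => ?_)
    dsimp only
    rw [lintegral_hlim_eq (norm_ne_zero_iff.2 ha)]
    exact lintegral_congr fun z => integrand_eq_lintegral_Flin ha z
  rw [h1]
  -- merge `(a, z)` and swap with `q`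
  have hG : Measurable fun w : EuclideanSpace ℝ (Fin 3) × (ℝ × ℝ) => ∫⁻ q, Flin (w, q) ∂rhoCU := measurable_Flin.lintegral_prod_right'
  have hGa : Measurable fun a : EuclideanSpace ℝ (Fin 3) => ∫⁻ z : ℝ × ℝ, ∫⁻ q, Flin ((a, z), q) ∂rhoCU := hG.lintegral_prod_right'
  have hsplit : (∫⁻ w : EuclideanSpace ℝ (Fin 3) × (ℝ × ℝ), ∫⁻ q, Flin (w, q) ∂rhoCU) =
      ∫⁻ a : EuclideanSpace ℝ (Fin 3), ∫⁻ z : ℝ × ℝ, ∫⁻ q, Flin ((a, z), q) ∂rhoCU := by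
    rw [Measure.volume_eq_prod]; exact lintegral_prod _ hG.aemeasurable
  have h2 : ∫⁻ a : EuclideanSpace ℝ (Fin 3), ∫⁻ z : ℝ × ℝ, ENNReal.ofReal (Real.pi ^ 2) * ∫⁻ q, Flin ((a, z), q) ∂rhoCU =
      ENNReal.ofReal (Real.pi ^ 2) * ∫⁻ w : EuclideanSpace ℝ (Fin 3) × (ℝ × ℝ), ∫⁻ q, Flin (w, q) ∂rhoCU := by
    rw [hsplit, ← lintegral_const_mul _ hGa]
    refine lintegral_congr fun a => ?_
    have hGz : Measurable fun z : ℝ × ℝ => ∫⁻ q, Flin ((a, z), q) ∂rhoCU := hG.comp (measurable_const.prodMk measurable_id)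
    rw [lintegral_const_mul _ hGz]
  have hunc : AEMeasurable (Function.uncurry fun (w : EuclideanSpace ℝ (Fin 3) × (ℝ × ℝ)) (q : ℝ × ℝ) => Flin (w, q))
      ((volume : Measure (EuclideanSpace ℝ (Fin 3) × (ℝ × ℝ))).prod rhoCU) := by
    have e : (Function.uncurry fun (w : EuclideanSpace ℝ (Fin 3) × (ℝ × ℝ)) (q : ℝ × ℝ) => Flin (w, q)) = Flin := by
      funext p; rfl
    rw [e]; exact measurable_Flin.aemeasurable
  rw [h2, lintegral_lintegral_swap hunc]

/-- ★★★ **THE CLOSED FORM `A₃ = 4π⁴√(2π)`** of the constant of ✓`tendsto_zeroModeZ_three` (`β²·Z₃(β) → A₃`).  HONEST LABEL: plan-level zero-mode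
constant (Gaussian model of the `k = 3` block); NOT ⟨24197⟩; the Yang–Mills mass gap is NOT proved. [folklore] -/
theorem A3_eq : A3 = 4 * Real.pi ^ 4 * Real.sqrt (2 * Real.pi) := by
  have hcu : ∫⁻ q, (∫⁻ w : EuclideanSpace ℝ (Fin 3) × (ℝ × ℝ), Flin (w, q)) ∂rhoCU =
      ENNReal.ofReal (Real.pi ^ 2 * Real.sqrt Real.pi) * ENNReal.ofReal (4 * Real.sqrt 2) := by
    have hm : Measurable fun q : ℝ × ℝ => ∫⁻ w : EuclideanSpace ℝ (Fin 3) × (ℝ × ℝ), Flin (w, q) :=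
      (measurable_Flin.comp measurable_swap).lintegral_prod_right'
    have hm2 : Measurable fun c : ℝ => ENNReal.ofReal (2 * c ^ (-(1/2 : ℝ))) * ENNReal.ofReal c⁻¹ :=
      (ENNReal.measurable_ofReal.comp (by fun_prop)).mul (ENNReal.measurable_ofReal.comp measurable_inv)
    rw [rhoCU, lintegral_prod _ hm.aemeasurable, setLIntegral_congr_fun measurableSet_Ioi (fun c hc => lintegral_u
      (by simp only [Set.mem_Ioi] at hc; linarith)), lintegral_const_mul _ hm2, lintegral_c]
  have h := ofReal_A3_eq_lintegral_Flin
  rw [hcu, ← ENNReal.ofReal_mul (by positivity), ← ENNReal.ofReal_mul (by positivity)] at h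
  have hval : Real.pi ^ 2 * (Real.pi ^ 2 * Real.sqrt Real.pi * (4 * Real.sqrt 2)) = 4 * Real.pi ^ 4 * Real.sqrt (2 * Real.pi) := by
    rw [Real.sqrt_mul (by norm_num : (0:ℝ) ≤ 2)]; ring
  rw [hval] at h
  have := congrArg ENNReal.toReal h
  rwa [ENNReal.toReal_ofReal A3_pos.le, ENNReal.toReal_ofReal (by positivity)] at this

end Summit.QuantumFields.YangMills.Theorems.ToronValleyVolume.ZeroMode

end
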